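import Summits.KontsevichZagierPeriods.KontsevichZagierPeriods.Theses.HurwitzMicroSectors
import Literature.NumberTheory.Transcendental.KZLogCalculusProofs
import Literature.NumberTheory.Transcendental.KZSemialgebraicComplex
import Literature.NumberTheory.Transcendental.KZSemiCanonicalReductionProofs

/-!
# `HurwitzSectorComplement` (stmt-KontsevichZagierPeriods-14341, route HurwitzMicroSectors),
# line `chebyshev-level-deformation`: stub `stub_clausenCells` (S5), auxiliary file 1 — the fibrewise chart

The Catalan–Clausen junction `[(0,1)², g(v)T(v;x)] ≡ [p₊] − [p₋]` (stub S5 of the line, proved in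
`HurwitzMicroSectorsHurwitzSectorComplementStubClausenCells.lean`) rests on the fibrewise
substitution `u = x² − 2c(v)x + 1`, `c(v) = (1 − v²)/(1 + v²)`, i.e. on the chart
`Ψ(x,v) = (v, u)` of `ℝ²` (source slots `x = y 0`, `v = y 1`; target slots `v = w 0`, `u = w 1`).
This file supplies its elementary analysis; `Ψ` and its Jacobian `Ψ'` enter as variables named by
their defining equations (no definition is made):

* `hasFDerivAt_chart`: `Ψ` is differentiable with Jacobian `!![0, 1; 2x − 2c(v), 8vx/(1+v²)²]`
  (`det = 2c(v) − 2x`, `det_chart`); `isSemialgebraicMapOn_chart` (polynomial/rational components);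
* `injOn_chart_minus/plus`: injectivity on the cells `{x < c(v)}`, `{c(v) < x}`, written
  polynomially as `{P > 0}`, `{P < 0}` with `P = (1 − v²) − (1 + v²)x`;
* `image_chart_minus/plus`: the images of the two cells of the open unit square are
  `E₁ = {0<v<1, 4v² < u(1+v²)², u < 1}` and `E₂ = {0<v<1, 4v² < u(1+v²)², u(1+v²) < 4v²}`
  (`u(1+v²)² − 4v² = P²`; inverse `x = c ∓ √(u − m)`, `m = 1 − c² = 4v²/(1+v²)²`);
* `pullback_minus/plus`: `g(v)T(v;x) = ±(1/((1+v²)u)) ∘ Ψ · |det Ψ'|` on the two cells;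
* `stub_clausenCells_aux1`: the package of these facts as one existential statement (the
  registered auxiliary stub this file lands), consumed by auxiliary file 2.

References: M. Kontsevich, D. Zagier, *Periods* (2001), §1.2 rule (2).
-/

noncomputable section

open Set MeasureTheory MvPolynomial
open scoped BigOperators
open Literature.NumberTheory.Transcendental
open Literature.ModelTheory.ExponentialFields (IsSemialgebraic)

namespace Summit.KontsevichZagierPeriods.Theorems.HurwitzMicroSectorsHurwitzSectorComplement

namespace ClausenCells

/-! ### The half-angle cosine `c(v) = (1 − v²)/(1 + v²)` -/

/-- For `0 < v < 1`: `c = (1 − v²)/(1 + v²) ∈ (0,1)`, `1 − c² = 4v²/(1+v²)²`, `2 − 2c = 4v²/(1+v²)`,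
`c · (1 + v²) = 1 − v²`. [folklore] -/
theorem c_facts {v : ℝ} (h0 : 0 < v) (h1 : v < 1) :
    0 < (1 - v ^ 2) / (1 + v ^ 2) ∧ (1 - v ^ 2) / (1 + v ^ 2) < 1 ∧
    1 - ((1 - v ^ 2) / (1 + v ^ 2)) ^ 2 = 4 * v ^ 2 / (1 + v ^ 2) ^ 2 ∧
    2 - 2 * ((1 - v ^ 2) / (1 + v ^ 2)) = 4 * v ^ 2 / (1 + v ^ 2) ∧
    (1 - v ^ 2) / (1 + v ^ 2) * (1 + v ^ 2) = 1 - v ^ 2 := by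
  have hv2 : v ^ 2 < 1 := by nlinarith
  have hp : (0:ℝ) < 1 + v ^ 2 := by positivity
  refine ⟨div_pos (by linarith) hp, (div_lt_one hp).mpr (by nlinarith), ?_, ?_,
    div_mul_cancel₀ _ hp.ne'⟩
  · field_simp
    ring
  · field_simp
    ring

/-- The derivative of `c(t) = (1 − t²)/(1 + t²)` is `−4t/(1+t²)²`. [folklore] -/
theorem hasDerivAt_cfun (t : ℝ) :
    HasDerivAt (fun s : ℝ => (1 - s ^ 2) / (1 + s ^ 2)) (-(4 * t) / (1 + t ^ 2) ^ 2) t := by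
  have h1 : HasDerivAt (fun s : ℝ => 1 - s ^ 2) (-(2 * t)) t := by
    simpa using (hasDerivAt_pow 2 t).const_sub 1
  have h2 : HasDerivAt (fun s : ℝ => 1 + s ^ 2) (2 * t) t := by
    simpa using (hasDerivAt_pow 2 t).const_add 1
  have hp : (1 : ℝ) + t ^ 2 ≠ 0 := by positivity
  refine (h1.div h2 hp).congr_deriv ?_
  field_simp
  ring

/-! ### The fibrewise chart `Ψ(x, v) = (v, x² − 2 c(v) x + 1)` and its Jacobian -/

/-- The determinant of the Jacobian matrix `!![0, 1; a, b]` is `−a`. [folklore] -/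
theorem det_chart (a b : ℝ) :
    (LinearMap.toContinuousLinearMap (Matrix.toLin' !![(0:ℝ), 1; a, b])).det = -a := by
  have h : (!![(0:ℝ), 1; a, b] : Matrix (Fin 2) (Fin 2) ℝ).det = -a := by
    simp [Matrix.det_fin_two]
  rw [← h]
  exact LinearMap.det_toLin' _

/-- Differentiability of the chart `Ψ(x,v) = (v, x² − 2c(v)x + 1)` with Jacobian
`!![0, 1; 2x − 2c(v), 8vx/(1+v²)²]`. [folklore] -/
theorem hasFDerivAt_chart {Ψ : (Fin 2 → ℝ) → Fin 2 → ℝ}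
    (hΨ : ∀ y, Ψ y = ![y 1, y 0 ^ 2 - 2 * ((1 - y 1 ^ 2) / (1 + y 1 ^ 2)) * y 0 + 1])
    {Ψ' : (Fin 2 → ℝ) → (Fin 2 → ℝ) →L[ℝ] (Fin 2 → ℝ)}
    (hΨ' : ∀ y, Ψ' y = LinearMap.toContinuousLinearMap (Matrix.toLin'
      !![(0:ℝ), 1; 2 * y 0 - 2 * ((1 - y 1 ^ 2) / (1 + y 1 ^ 2)), 8 * y 1 * y 0 / (1 + y 1 ^ 2) ^ 2]))
    (y : Fin 2 → ℝ) : HasFDerivAt Ψ (Ψ' y) y := by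
  have p0 : HasFDerivAt (fun z : Fin 2 → ℝ => z 0)
      (ContinuousLinearMap.proj (R := ℝ) (φ := fun _ : Fin 2 => ℝ) 0) y := hasFDerivAt_apply 0 y
  have p1 : HasFDerivAt (fun z : Fin 2 → ℝ => z 1)
      (ContinuousLinearMap.proj (R := ℝ) (φ := fun _ : Fin 2 => ℝ) 1) y := hasFDerivAt_apply 1 y
  have hc := (hasDerivAt_cfun (y 1)).comp_hasFDerivAt y p1
  have hF : HasFDerivAt
      (fun z : Fin 2 → ℝ => z 0 ^ 2 - 2 * ((1 - z 1 ^ 2) / (1 + z 1 ^ 2)) * z 0 + 1) _ y :=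
    (((p0.pow 2).fun_sub ((hc.const_mul (2:ℝ)).fun_mul p0)).add_const 1)
  have c0 : HasFDerivAt (fun z : Fin 2 → ℝ => Ψ z 0)
      ((ContinuousLinearMap.proj 0).comp (Ψ' y)) y := by
    have hfun : (fun z : Fin 2 → ℝ => Ψ z 0) = fun z => z 1 := by
      funext z; simp [hΨ]
    rw [hfun]
    refine p1.congr_fderiv ?_
    ext v
    simp [hΨ', dotProduct, Fin.sum_univ_two]
  have c1 : HasFDerivAt (fun z : Fin 2 → ℝ => Ψ z 1)
      ((ContinuousLinearMap.proj 1).comp (Ψ' y)) y := by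
    have hfun : (fun z : Fin 2 → ℝ => Ψ z 1) =
        fun z => z 0 ^ 2 - 2 * ((1 - z 1 ^ 2) / (1 + z 1 ^ 2)) * z 0 + 1 := by
      funext z; simp [hΨ]
    rw [hfun]
    refine hF.congr_fderiv ?_
    ext v
    simp [hΨ', dotProduct, Fin.sum_univ_two, Function.comp]
    ring
  rw [hasFDerivAt_pi']
  intro i
  fin_cases i
  · exact c0
  · exact c1

/-- The chart is a `ℚ`-semialgebraic map (a polynomial and a rational component, denominator
`1 + v² > 0`). [folklore] -/
theorem isSemialgebraicMapOn_chart {Ψ : (Fin 2 → ℝ) → Fin 2 → ℝ}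
    (hΨ : ∀ y, Ψ y = ![y 1, y 0 ^ 2 - 2 * ((1 - y 1 ^ 2) / (1 + y 1 ^ 2)) * y 0 + 1])
    {s : Set (Fin 2 → ℝ)} (hs : IsSemialgebraic ℚ s) : IsSemialgebraicMapOn ℚ s Ψ := by
  refine IsSemialgebraicMapOn.of_forall hs fun j => ?_
  fin_cases j
  · exact (isSemialgebraicFunOn_aeval hs (X 1)).congr fun y _ => by simp [hΨ]
  · refine (isSemialgebraicFunOn_aeval_div_aeval hs
      (X 0 ^ 2 * (1 + X 1 ^ 2) - 2 * (1 - X 1 ^ 2) * X 0 + (1 + X 1 ^ 2) : MvPolynomial (Fin 2) ℚ)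
      (1 + X 1 ^ 2) fun y _ => ?_).congr fun y _ => ?_
    · simp only [map_add, map_one, map_pow, aeval_X]
      positivity
    · have h : (1:ℝ) + y 1 ^ 2 ≠ 0 := by positivity
      simp [hΨ]
      field_simp

/-- The chart is injective on the cell `{x < c(v)}` (where `u` is decreasing in `x`). [folklore] -/
theorem injOn_chart_minus {Ψ : (Fin 2 → ℝ) → Fin 2 → ℝ}
    (hΨ : ∀ y, Ψ y = ![y 1, y 0 ^ 2 - 2 * ((1 - y 1 ^ 2) / (1 + y 1 ^ 2)) * y 0 + 1]) :
    InjOn Ψ {y : Fin 2 → ℝ | 0 < (1 - y 1 ^ 2) - (1 + y 1 ^ 2) * y 0} := by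
  intro y hy y' hy' h
  have h0 : y 1 = y' 1 := by simpa [hΨ] using congrFun h 0
  have h1 : y 0 ^ 2 - 2 * ((1 - y 1 ^ 2) / (1 + y 1 ^ 2)) * y 0 + 1 =
      y' 0 ^ 2 - 2 * ((1 - y' 1 ^ 2) / (1 + y' 1 ^ 2)) * y' 0 + 1 := by
    simpa [hΨ] using congrFun h 1
  simp only [mem_setOf_eq] at hy hy'
  rw [← h0] at h1 hy'
  have hp : (0:ℝ) < 1 + y 1 ^ 2 := by positivity
  set c := (1 - y 1 ^ 2) / (1 + y 1 ^ 2) with hc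
  have hx : y 0 < c := by rw [hc, lt_div_iff₀ hp]; linarith
  have hx' : y' 0 < c := by rw [hc, lt_div_iff₀ hp]; linarith
  have hprod : (y 0 - y' 0) * (y 0 + y' 0 - 2 * c) = 0 := by linear_combination h1
  rcases mul_eq_zero.mp hprod with h2 | h2
  · funext i
    fin_cases i
    · exact sub_eq_zero.mp h2
    · exact h0
  · exfalso
    linarith

/-- The chart is injective on the cell `{c(v) < x}` (where `u` is increasing in `x`). [folklore] -/
theorem injOn_chart_plus {Ψ : (Fin 2 → ℝ) → Fin 2 → ℝ}
    (hΨ : ∀ y, Ψ y = ![y 1, y 0 ^ 2 - 2 * ((1 - y 1 ^ 2) / (1 + y 1 ^ 2)) * y 0 + 1]) :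
    InjOn Ψ {y : Fin 2 → ℝ | (1 - y 1 ^ 2) - (1 + y 1 ^ 2) * y 0 < 0} := by
  intro y hy y' hy' h
  have h0 : y 1 = y' 1 := by simpa [hΨ] using congrFun h 0
  have h1 : y 0 ^ 2 - 2 * ((1 - y 1 ^ 2) / (1 + y 1 ^ 2)) * y 0 + 1 =
      y' 0 ^ 2 - 2 * ((1 - y' 1 ^ 2) / (1 + y' 1 ^ 2)) * y' 0 + 1 := by
    simpa [hΨ] using congrFun h 1
  simp only [mem_setOf_eq] at hy hy'
  rw [← h0] at h1 hy'
  have hp : (0:ℝ) < 1 + y 1 ^ 2 := by positivity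
  set c := (1 - y 1 ^ 2) / (1 + y 1 ^ 2) with hc
  have hx : c < y 0 := by rw [hc, div_lt_iff₀ hp]; linarith
  have hx' : c < y' 0 := by rw [hc, div_lt_iff₀ hp]; linarith
  have hprod : (y 0 - y' 0) * (y 0 + y' 0 - 2 * c) = 0 := by linear_combination h1
  rcases mul_eq_zero.mp hprod with h2 | h2
  · funext i
    fin_cases i
    · exact sub_eq_zero.mp h2
    · exact h0
  · exfalso
    linarith


/-! ### Images of the two cells -/

/-- The chart carries the cell `{0<x<1, 0<v<1, x < c(v)}` onto `E₁ = {0<v<1, m(v) < u < 1}`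
(`m(v) = 4v²/(1+v²)²`, i.e. `4v² < u(1+v²)²`; inverse `x = c − √(u − m)`). [folklore] -/
theorem image_chart_minus {Ψ : (Fin 2 → ℝ) → Fin 2 → ℝ}
    (hΨ : ∀ y, Ψ y = ![y 1, y 0 ^ 2 - 2 * ((1 - y 1 ^ 2) / (1 + y 1 ^ 2)) * y 0 + 1]) :
    Ψ '' ({y : Fin 2 → ℝ | y 0 ∈ Ioo (0:ℝ) 1 ∧ y 1 ∈ Ioo (0:ℝ) 1} ∩
      {y | 0 < (1 - y 1 ^ 2) - (1 + y 1 ^ 2) * y 0}) =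
    {w | 0 < w 0 ∧ w 0 < 1 ∧ 4 * w 0 ^ 2 < w 1 * (1 + w 0 ^ 2) ^ 2 ∧ w 1 < 1} := by
  apply Subset.antisymm
  · rintro _ ⟨y, ⟨⟨⟨hx0, hx1⟩, ⟨hv0, hv1⟩⟩, hP⟩, rfl⟩
    simp only [mem_setOf_eq] at hP
    have hp : (0:ℝ) < 1 + y 1 ^ 2 := by positivity
    simp only [mem_setOf_eq, hΨ, Matrix.cons_val_zero, Matrix.cons_val_one]
    set c := (1 - y 1 ^ 2) / (1 + y 1 ^ 2) with hc
    have hxc : y 0 < c := by rw [hc, lt_div_iff₀ hp]; linarith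
    have key : (y 0 ^ 2 - 2 * c * y 0 + 1) * (1 + y 1 ^ 2) ^ 2 - 4 * y 1 ^ 2 =
        ((1 - y 1 ^ 2) - (1 + y 1 ^ 2) * y 0) ^ 2 := by
      rw [hc]
      field_simp
      ring
    refine ⟨hv0, hv1, ?_, ?_⟩
    · nlinarith [sq_pos_of_pos hP, key]
    · nlinarith [mul_pos hx0 (show 0 < 2 * c - y 0 by linarith)]
  · rintro w ⟨hv0, hv1, hm, hu1⟩
    have hp : (0:ℝ) < 1 + w 0 ^ 2 := by positivity
    obtain ⟨hc0, hc1, hcm2, -, hcm⟩ := c_facts hv0 hv1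
    set c := (1 - w 0 ^ 2) / (1 + w 0 ^ 2) with hc
    have hum : 0 < w 1 - (1 - c ^ 2) := by
      rw [hcm2, sub_pos, div_lt_iff₀ (by positivity)]
      linarith
    set s := Real.sqrt (w 1 - (1 - c ^ 2)) with hs
    have hs0 : 0 < s := Real.sqrt_pos.mpr hum
    have hs2 : s ^ 2 = w 1 - (1 - c ^ 2) := Real.sq_sqrt hum.le
    have hsc : s < c := (Real.sqrt_lt' hc0).mpr (by linarith)
    refine ⟨![c - s, w 0], ⟨⟨?_, ?_⟩, ?_⟩, ?_⟩
    · simp only [Matrix.cons_val_zero]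
      exact ⟨by linarith, by linarith⟩
    · simp only [Matrix.cons_val_one, Matrix.cons_val_fin_one]
      exact ⟨hv0, hv1⟩
    · simp only [mem_setOf_eq, Matrix.cons_val_zero, Matrix.cons_val_one, Matrix.cons_val_fin_one]
      nlinarith [hcm, mul_pos hp hs0]
    · funext i
      fin_cases i
      · simp [hΨ]
      · simp only [hΨ, Matrix.cons_val_zero, Matrix.cons_val_one, Matrix.cons_val_fin_one,
          Fin.mk_one]
        rw [← hc]
        linear_combination hs2

/-- The chart carries the cell `{0<x<1, 0<v<1, c(v) < x}` onto `E₂ = {0<v<1, m(v) < u < M(v)}`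
(`M(v) = 4v²/(1+v²)`, i.e. `u(1+v²) < 4v²`; inverse `x = c + √(u − m)`). [folklore] -/
theorem image_chart_plus {Ψ : (Fin 2 → ℝ) → Fin 2 → ℝ}
    (hΨ : ∀ y, Ψ y = ![y 1, y 0 ^ 2 - 2 * ((1 - y 1 ^ 2) / (1 + y 1 ^ 2)) * y 0 + 1]) :
    Ψ '' ({y : Fin 2 → ℝ | y 0 ∈ Ioo (0:ℝ) 1 ∧ y 1 ∈ Ioo (0:ℝ) 1} ∩
      {y | (1 - y 1 ^ 2) - (1 + y 1 ^ 2) * y 0 < 0}) =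
    {w | 0 < w 0 ∧ w 0 < 1 ∧ 4 * w 0 ^ 2 < w 1 * (1 + w 0 ^ 2) ^ 2 ∧
      w 1 * (1 + w 0 ^ 2) < 4 * w 0 ^ 2} := by
  apply Subset.antisymm
  · rintro _ ⟨y, ⟨⟨⟨hx0, hx1⟩, ⟨hv0, hv1⟩⟩, hP⟩, rfl⟩
    simp only [mem_setOf_eq] at hP
    have hp : (0:ℝ) < 1 + y 1 ^ 2 := by positivity
    obtain ⟨hc0, hc1, -, -, hcm⟩ := c_facts hv0 hv1
    simp only [mem_setOf_eq, hΨ, Matrix.cons_val_zero, Matrix.cons_val_one]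
    set c := (1 - y 1 ^ 2) / (1 + y 1 ^ 2) with hc
    have hxc : c < y 0 := by rw [hc, div_lt_iff₀ hp]; linarith
    have key : (y 0 ^ 2 - 2 * c * y 0 + 1) * (1 + y 1 ^ 2) ^ 2 - 4 * y 1 ^ 2 =
        ((1 - y 1 ^ 2) - (1 + y 1 ^ 2) * y 0) ^ 2 := by
      rw [hc]
      field_simp
      ring
    have key2 : (y 0 ^ 2 - 2 * c * y 0 + 1) * (1 + y 1 ^ 2) - 4 * y 1 ^ 2 =
        -((1 - y 0) * ((y 0 + 1) * (1 + y 1 ^ 2) - 2 * (1 - y 1 ^ 2))) := by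
      rw [hc]
      field_simp
      ring
    refine ⟨hv0, hv1, ?_, ?_⟩
    · nlinarith [sq_pos_of_neg hP, key]
    · have h3 : 0 < (1 - y 0) * ((y 0 + 1) * (1 + y 1 ^ 2) - 2 * (1 - y 1 ^ 2)) :=
        mul_pos (by linarith) (by nlinarith)
      linarith [key2, h3]
  · rintro w ⟨hv0, hv1, hm, hM⟩
    have hp : (0:ℝ) < 1 + w 0 ^ 2 := by positivity
    obtain ⟨hc0, hc1, hcm2, h22, hcm⟩ := c_facts hv0 hv1
    set c := (1 - w 0 ^ 2) / (1 + w 0 ^ 2) with hc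
    have hum : 0 < w 1 - (1 - c ^ 2) := by
      rw [hcm2, sub_pos, div_lt_iff₀ (by positivity)]
      linarith
    have hu2 : w 1 < 2 - 2 * c := by
      rw [h22, lt_div_iff₀ hp]
      linarith
    set s := Real.sqrt (w 1 - (1 - c ^ 2)) with hs
    have hs0 : 0 < s := Real.sqrt_pos.mpr hum
    have hs2 : s ^ 2 = w 1 - (1 - c ^ 2) := Real.sq_sqrt hum.le
    have hsc : s < 1 - c := (Real.sqrt_lt' (by linarith)).mpr (by nlinarith)
    refine ⟨![c + s, w 0], ⟨⟨?_, ?_⟩, ?_⟩, ?_⟩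
    · simp only [Matrix.cons_val_zero]
      exact ⟨by linarith, by linarith⟩
    · simp only [Matrix.cons_val_one, Matrix.cons_val_fin_one]
      exact ⟨hv0, hv1⟩
    · simp only [mem_setOf_eq, Matrix.cons_val_zero, Matrix.cons_val_one, Matrix.cons_val_fin_one]
      nlinarith [hcm, mul_pos hp hs0]
    · funext i
      fin_cases i
      · simp [hΨ]
      · simp only [hΨ, Matrix.cons_val_zero, Matrix.cons_val_one, Matrix.cons_val_fin_one,
          Fin.mk_one]
        rw [← hc]
        linear_combination hs2

/-! ### The pullback identities `g(v)T(v;x) = ±(1/((1+v²)u)) ∘ Ψ · |det Ψ'|` -/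

/-- PULLBACK IDENTITY on the cell `{x < c(v)}`. [folklore] -/
theorem pullback_minus {Ψ : (Fin 2 → ℝ) → Fin 2 → ℝ}
    (hΨ : ∀ y, Ψ y = ![y 1, y 0 ^ 2 - 2 * ((1 - y 1 ^ 2) / (1 + y 1 ^ 2)) * y 0 + 1])
    {Ψ' : (Fin 2 → ℝ) → (Fin 2 → ℝ) →L[ℝ] (Fin 2 → ℝ)}
    (hΨ' : ∀ y, Ψ' y = LinearMap.toContinuousLinearMap (Matrix.toLin'
      !![(0:ℝ), 1; 2 * y 0 - 2 * ((1 - y 1 ^ 2) / (1 + y 1 ^ 2)), 8 * y 1 * y 0 / (1 + y 1 ^ 2) ^ 2]))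
    {y : Fin 2 → ℝ} (hy : y ∈ {y : Fin 2 → ℝ | y 0 ∈ Ioo (0:ℝ) 1 ∧ y 1 ∈ Ioo (0:ℝ) 1} ∩
      {y | 0 < (1 - y 1 ^ 2) - (1 + y 1 ^ 2) * y 0}) :
    2 / (1 + y 1 ^ 2) * (((1 - y 1 ^ 2) - (1 + y 1 ^ 2) * y 0) /
        ((1 - y 0) ^ 2 + y 1 ^ 2 * (1 + y 0) ^ 2)) =
      1 / ((1 + (Ψ y) 0 ^ 2) * (Ψ y) 1) * |(Ψ' y).det| := by
  obtain ⟨⟨⟨hx0, hx1⟩, ⟨hv0, hv1⟩⟩, hP⟩ := hy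
  simp only [mem_setOf_eq] at hP
  have hp : (0:ℝ) < 1 + y 1 ^ 2 := by positivity
  obtain ⟨-, -, -, -, hcm⟩ := c_facts hv0 hv1
  rw [hΨ', det_chart]
  simp only [hΨ, Matrix.cons_val_zero, Matrix.cons_val_one]
  set c := (1 - y 1 ^ 2) / (1 + y 1 ^ 2) with hc
  have hxc : y 0 < c := by rw [hc, lt_div_iff₀ hp]; linarith
  have hN : (1 - y 0) ^ 2 + y 1 ^ 2 * (1 + y 0) ^ 2 ≠ 0 :=
    (add_pos_of_pos_of_nonneg (pow_pos (sub_pos.2 hx1) 2) (by positivity)).ne'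
  have hNu : (1 + y 1 ^ 2) * (y 0 ^ 2 - 2 * c * y 0 + 1) =
      (1 - y 0) ^ 2 + y 1 ^ 2 * (1 + y 0) ^ 2 := by
    linear_combination (-(2:ℝ) * y 0) * hcm
  rw [abs_of_pos (by linarith), hNu, hc]
  field_simp
  ring

/-- PULLBACK IDENTITY on the cell `{c(v) < x}` (the integrand is negative there). [folklore] -/
theorem pullback_plus {Ψ : (Fin 2 → ℝ) → Fin 2 → ℝ}
    (hΨ : ∀ y, Ψ y = ![y 1, y 0 ^ 2 - 2 * ((1 - y 1 ^ 2) / (1 + y 1 ^ 2)) * y 0 + 1])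
    {Ψ' : (Fin 2 → ℝ) → (Fin 2 → ℝ) →L[ℝ] (Fin 2 → ℝ)}
    (hΨ' : ∀ y, Ψ' y = LinearMap.toContinuousLinearMap (Matrix.toLin'
      !![(0:ℝ), 1; 2 * y 0 - 2 * ((1 - y 1 ^ 2) / (1 + y 1 ^ 2)), 8 * y 1 * y 0 / (1 + y 1 ^ 2) ^ 2]))
    {y : Fin 2 → ℝ} (hy : y ∈ {y : Fin 2 → ℝ | y 0 ∈ Ioo (0:ℝ) 1 ∧ y 1 ∈ Ioo (0:ℝ) 1} ∩
      {y | (1 - y 1 ^ 2) - (1 + y 1 ^ 2) * y 0 < 0}) :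
    2 / (1 + y 1 ^ 2) * (((1 - y 1 ^ 2) - (1 + y 1 ^ 2) * y 0) /
        ((1 - y 0) ^ 2 + y 1 ^ 2 * (1 + y 0) ^ 2)) =
      -(1 / ((1 + (Ψ y) 0 ^ 2) * (Ψ y) 1)) * |(Ψ' y).det| := by
  obtain ⟨⟨⟨hx0, hx1⟩, ⟨hv0, hv1⟩⟩, hP⟩ := hy
  simp only [mem_setOf_eq] at hP
  have hp : (0:ℝ) < 1 + y 1 ^ 2 := by positivity
  obtain ⟨-, -, -, -, hcm⟩ := c_facts hv0 hv1
  rw [hΨ', det_chart]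
  simp only [hΨ, Matrix.cons_val_zero, Matrix.cons_val_one]
  set c := (1 - y 1 ^ 2) / (1 + y 1 ^ 2) with hc
  have hxc : c < y 0 := by rw [hc, div_lt_iff₀ hp]; linarith
  have hN : (1 - y 0) ^ 2 + y 1 ^ 2 * (1 + y 0) ^ 2 ≠ 0 :=
    (add_pos_of_pos_of_nonneg (pow_pos (sub_pos.2 hx1) 2) (by positivity)).ne'
  have hNu : (1 + y 1 ^ 2) * (y 0 ^ 2 - 2 * c * y 0 + 1) =
      (1 - y 0) ^ 2 + y 1 ^ 2 * (1 + y 0) ^ 2 := by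
    linear_combination (-(2:ℝ) * y 0) * hcm
  rw [abs_of_neg (by linarith), hNu, hc]
  field_simp
  ring

end ClausenCells

open ClausenCells in
/-- **Auxiliary stub 1 of S5 (the fibrewise chart, packaged).** There is a chart `Ψ` of `ℝ²` with a
Jacobian field `Ψ'` — namely `Ψ(x,v) = (v, x² − 2c(v)x + 1)`, `c(v) = (1−v²)/(1+v²)` — which is
everywhere differentiable, `ℚ`-semialgebraic on every `ℚ`-semialgebraic set, injective on the two
cells `{P > 0}`, `{P < 0}` (`P = (1−v²) − (1+v²)x`), carries the two cells of the open unit square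
onto `E₁ = {0<v<1, 4v² < u(1+v²)², u < 1}` and `E₂ = {0<v<1, 4v² < u(1+v²)², u(1+v²) < 4v²}`, and
pulls `±1/((1+v²)u) · |det Ψ'|` back to `g(v)T(v;x)`: exactly the side conditions of
Kontsevich–Zagier's rule (2) for the two moves of the Catalan–Clausen junction.
[cite: KontsevichZagier2001, §1.2 rule (2)] -/
theorem stub_clausenCells_aux1 : ∃ (Ψ : (Fin 2 → ℝ) → Fin 2 → ℝ) (Ψ' : (Fin 2 → ℝ) → (Fin 2 → ℝ) →L[ℝ] (Fin 2 → ℝ)), (∀ y, HasFDerivAt Ψ (Ψ' y) y) ∧ (∀ s : Set (Fin 2 → ℝ), Literature.ModelTheory.ExponentialFields.IsSemialgebraic ℚ s → IsSemialgebraicMapOn ℚ s Ψ) ∧ Set.InjOn Ψ {y | 0 < (1 - y 1 ^ 2) - (1 + y 1 ^ 2) * y 0} ∧ Set.InjOn Ψ {y | (1 - y 1 ^ 2) - (1 + y 1 ^ 2) * y 0 < 0} ∧ Ψ '' ({y | y 0 ∈ Set.Ioo (0:ℝ) 1 ∧ y 1 ∈ Set.Ioo (0:ℝ) 1} ∩ {y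 | 0 < (1 - y 1 ^ 2) - (1 + y 1 ^ 2) * y 0}) = {w | 0 < w 0 ∧ w 0 < 1 ∧ 4 * w 0 ^ 2 < w 1 * (1 + w 0 ^ 2) ^ 2 ∧ w 1 < 1} ∧ Ψ '' ({y | y 0 ∈ Set.Ioo (0:ℝ) 1 ∧ y 1 ∈ Set.Ioo (0:ℝ) 1} ∩ {y | (1 - y 1 ^ 2) - (1 + y 1 ^ 2) * y 0 < 0}) = {w | 0 < w 0 ∧ w 0 < 1 ∧ 4 * w 0 ^ 2 < w 1 * (1 + w 0 ^ 2) ^ 2 ∧ w 1 * (1 + w 0 ^ 2) < 4 * w 0 ^ 2} ∧ (∀ y ∈ {y : Fin 2 → ℝ | y 0 ∈ Set.Ioo (0:ℝ) 1 ∧ y 1 ∈ Set.Ioo (0:ℝ) 1} ∩ {y | 0 < (1 - y 1 ^ 2) - (1 + y 1 ^ 2) * y 0}, 2 / (1 + y 1 ^ 2) * (((1 - y 1 ^ 2) - (1 + y 1 ^ 2) * y 0) / ((1 - y 0) ^ 2 + y 1 ^ 2 * (1 + y 0) ^ 2)) = 1 / ((1 + (Ψ y) 0 ^ 2) * (Ψ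 y) 1) * |(Ψ' y).det|) ∧ (∀ y ∈ {y : Fin 2 → ℝ | y 0 ∈ Set.Ioo (0:ℝ) 1 ∧ y 1 ∈ Set.Ioo (0:ℝ) 1} ∩ {y | (1 - y 1 ^ 2) - (1 + y 1 ^ 2) * y 0 < 0}, 2 / (1 + y 1 ^ 2) * (((1 - y 1 ^ 2) - (1 + y 1 ^ 2) * y 0) / ((1 - y 0) ^ 2 + y 1 ^ 2 * (1 + y 0) ^ 2)) = -(1 / ((1 + (Ψ y) 0 ^ 2) * (Ψ y) 1)) * |(Ψ' y).det|) := by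
  obtain ⟨Ψ, hΨ⟩ : ∃ Ψ : (Fin 2 → ℝ) → Fin 2 → ℝ,
      ∀ y, Ψ y = ![y 1, y 0 ^ 2 - 2 * ((1 - y 1 ^ 2) / (1 + y 1 ^ 2)) * y 0 + 1] := ⟨_, fun _ => rfl⟩
  obtain ⟨Ψ', hΨ'⟩ : ∃ Ψ' : (Fin 2 → ℝ) → (Fin 2 → ℝ) →L[ℝ] (Fin 2 → ℝ),
      ∀ y, Ψ' y = LinearMap.toContinuousLinearMap (Matrix.toLin'
        !![(0:ℝ), 1; 2 * y 0 - 2 * ((1 - y 1 ^ 2) / (1 + y 1 ^ 2)), 8 * y 1 * y 0 / (1 + y 1 ^ 2) ^ 2]) :=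
    ⟨_, fun _ => rfl⟩
  exact ⟨Ψ, Ψ', hasFDerivAt_chart hΨ hΨ', fun s hs => isSemialgebraicMapOn_chart hΨ hs,
    injOn_chart_minus hΨ, injOn_chart_plus hΨ, image_chart_minus hΨ, image_chart_plus hΨ,
    fun y hy => pullback_minus hΨ hΨ' hy, fun y hy => pullback_plus hΨ hΨ' hy⟩

end Summit.KontsevichZagierPeriods.Theorems.HurwitzMicroSectorsHurwitzSectorComplement

end
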